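import Summits.PneNP.PneNP.Theorems.ConvexRankGatesCliqueExtLowerBoundAndPad
import Summits.PneNP.PneNP.Theorems.ConvexRankGatesCliqueExtLowerBoundPermAndPad
import Literature.Computability.Complexity.ExtMonotoneGates
import Literature.Computability.Complexity.CliqueTestGraphs
import Literature.Computability.Complexity.MonotoneSwitching
import Mathlib

/-!
# Wideness is free, PERM leaf: the r7 PERM leaf implies the r8 PERM leaf
(stub `permCnfAll_of_permCnf` of the line `width-threshold-certificate-sparsity`, reshape r8 of lead c12;
crux `ConvexRankGates.CliqueExtLowerBound`, stmt-PneNP-10682)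

The r7 PERM leaf speaks about PERM gates on `≤ m^c` points that are NOT NARROW (neither a PERM nor a
GRANK gate of width `≤ ⌊m^{1/16}⌋₊`); the r8 PERM leaf drops the side condition. The side condition is
idle: given a PERM gate `φ` on `≤ m^c` points composed with `s`-local CNFs `C` of the edges, pad `φ` with
`n' := ⌊m^{1/16}⌋₊ (log₂ ⌊m^{1/16}⌋₊ + 1) + 1` dummy wires under a conjunction and feed the dummies with
the empty (constant-true) CNF. The padded gate is a PERM gate on `≤ m^c + 2n' ≤ m^{c+1}` points
(`PermAndPad.isPermGate_andPad`, `AndPad.eventually_pad_numerics`), it is not narrow as soon as `φ`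
accepts something (`AndPad.not_narrow_andPad`), its children are as local and at most one more in number
(`AndPad.andPad_local`, `AndPad.card_image_andPad_le`), and its composed function of the edges is the
composed function of `φ` (`AndPad.andPad_cval`). So the r7 leaf at level `c + 1` delivers a legal local
sandwich of the SAME function with the better error factor `1/(8m^{c+2}) ≤ 1/(8m^{c+1})`. If `φ` accepts
nothing, the empty DNF and the CNF `{∅}` (one empty clause) sandwich the constant `0` with no error.
Everything here is bookkeeping. [folklore]
-/

-- summit and problem are both named `PneNP`, so every declaration lives in `Summit.PneNP.PneNP.…`
set_option linter.dupNamespace false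

open Literature.Computability.Complexity Filter Finset

namespace Summit.PneNP.PneNP.Theorems.CliqueExtLowerBound.WidthThreshold.PermPadLeaf

open Summit.PneNP.PneNP.Theorems.CliqueExtLowerBound.WidthThreshold.AndPad
  (andPad_cval card_image_andPad_le andPad_local not_narrow_andPad eventually_pad_numerics)
open Summit.PneNP.PneNP.Theorems.CliqueExtLowerBound.WidthThreshold.PermAndPad (isPermGate_andPad)

open Classical in
/-- **Wideness is free (PERM)**: the r7 PERM leaf text (PERM gates on `≤ m^c` points that are not narrow,
all levels `c`) implies the r8 PERM leaf text (every PERM gate on `≤ m^c` points, all levels `c`).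
Given `φ` and children `C` at level `c`: if `φ` accepts nothing, `dnf := ∅`, `cnf := {∅}` is a legal
local pair with empty error sets; otherwise pad `φ` with `n' = ⌊m^{1/16}⌋₊(log₂⌊m^{1/16}⌋₊ + 1) + 1`
dummy wires under `∧` (a PERM gate on `≤ m^{c+1}` points by `isPermGate_andPad` and
`eventually_pad_numerics`, not narrow by `not_narrow_andPad`), feed the dummies with the empty CNF
(`andPad_local`, `card_image_andPad_le`), apply the r7 leaf at level `c + 1`, and transport the two error
bounds along `andPad_cval` (same composed function) and `1/(8m^{c+2}) ≤ 1/(8m^{c+1})`. [folklore] -/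
theorem permCnfAll_of_permCnf :
    (∀ c : ℕ, ∃ r₀ s₀ : ℕ, 2 ≤ r₀ ∧ 2 ≤ s₀ ∧ ∀ r s : ℕ, r₀ ≤ r → s₀ ≤ s →
    ∀ᶠ m : ℕ in atTop, ∀ φ : GateFn, IsPermGate (m ^ c) φ →
      ¬ (IsPermGate ⌊(m : ℝ) ^ (1 / 16 : ℝ)⌋₊ φ ∨ IsGRankGate ⌊(m : ℝ) ^ (1 / 16 : ℝ)⌋₊ φ) →
      ∀ C : Fin φ.1 → Finset (Finset ((⊤ : SimpleGraph (Fin m)).edgeSet)),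
        #(univ.image C) ≤ m ^ (c + 3) → (∀ j, ∀ S ∈ C j, #S ≤ s - 1) →
        ∃ dnf cnf : Finset (Finset ((⊤ : SimpleGraph (Fin m)).edgeSet)),
          (∀ R ∈ dnf, #R ≤ r - 1) ∧ (∀ S ∈ cnf, #S ≤ s - 1) ∧
          (∀ x, EvalDNF dnf x → EvalCNF cnf x) ∧
          (#((posGraphs m ⌈(m : ℝ) ^ (1 / 4 : ℝ)⌉₊).filter
              (fun x => φ.2 (fun j => decide (EvalCNF (C j) x)) = true ∧ ¬ EvalDNF dnf x)) : ℝ)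
            ≤ (1 / (8 * (m : ℝ) ^ (c + 1))) * #(posGraphs m ⌈(m : ℝ) ^ (1 / 4 : ℝ)⌉₊) ∧
          (#((((powersetCard (Fintype.card ((⊤ : SimpleGraph (Fin m)).edgeSet) / ⌊(m : ℝ) ^ (1 / 8 : ℝ)⌋₊)
          (univ : Finset ((⊤ : SimpleGraph (Fin m)).edgeSet))).image (fun M => fun e => decide (e ∉ M)))).filter
              (fun x => EvalCNF cnf x ∧ φ.2 (fun j => decide (EvalCNF (C j) x)) = false)) : ℝ)
            ≤ (1 / (8 * (m : ℝ) ^ (c + 1))) *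
              #(((powersetCard (Fintype.card ((⊤ : SimpleGraph (Fin m)).edgeSet) / ⌊(m : ℝ) ^ (1 / 8 : ℝ)⌋₊)
          (univ : Finset ((⊤ : SimpleGraph (Fin m)).edgeSet))).image (fun M => fun e => decide (e ∉ M))))) →
    (∀ c : ℕ, ∃ r₀ s₀ : ℕ, 2 ≤ r₀ ∧ 2 ≤ s₀ ∧ ∀ r s : ℕ, r₀ ≤ r → s₀ ≤ s →
    ∀ᶠ m : ℕ in atTop, ∀ φ : GateFn, IsPermGate (m ^ c) φ →
      ∀ C : Fin φ.1 → Finset (Finset ((⊤ : SimpleGraph (Fin m)).edgeSet)),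
        #(univ.image C) ≤ m ^ (c + 3) → (∀ j, ∀ S ∈ C j, #S ≤ s - 1) →
        ∃ dnf cnf : Finset (Finset ((⊤ : SimpleGraph (Fin m)).edgeSet)),
          (∀ R ∈ dnf, #R ≤ r - 1) ∧ (∀ S ∈ cnf, #S ≤ s - 1) ∧
          (∀ x, EvalDNF dnf x → EvalCNF cnf x) ∧
          (#((posGraphs m ⌈(m : ℝ) ^ (1 / 4 : ℝ)⌉₊).filter
              (fun x => φ.2 (fun j => decide (EvalCNF (C j) x)) = true ∧ ¬ EvalDNF dnf x)) : ℝ)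
            ≤ (1 / (8 * (m : ℝ) ^ (c + 1))) * #(posGraphs m ⌈(m : ℝ) ^ (1 / 4 : ℝ)⌉₊) ∧
          (#((((powersetCard (Fintype.card ((⊤ : SimpleGraph (Fin m)).edgeSet) / ⌊(m : ℝ) ^ (1 / 8 : ℝ)⌋₊)
          (univ : Finset ((⊤ : SimpleGraph (Fin m)).edgeSet))).image (fun M => fun e => decide (e ∉ M)))).filter
              (fun x => EvalCNF cnf x ∧ φ.2 (fun j => decide (EvalCNF (C j) x)) = false)) : ℝ)
            ≤ (1 / (8 * (m : ℝ) ^ (c + 1))) *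
              #(((powersetCard (Fintype.card ((⊤ : SimpleGraph (Fin m)).edgeSet) / ⌊(m : ℝ) ^ (1 / 8 : ℝ)⌋₊)
          (univ : Finset ((⊤ : SimpleGraph (Fin m)).edgeSet))).image (fun M => fun e => decide (e ∉ M))))) := by
  intro h c
  obtain ⟨r₀, s₀, hr₀, hs₀, H⟩ := h (c + 1)
  refine ⟨r₀, s₀, hr₀, hs₀, fun r s hr hs => ?_⟩
  filter_upwards [H r s hr hs, eventually_pad_numerics c, eventually_ge_atTop 1] with m hm hnum hm1
  intro φ hφ C hC hCs
  obtain ⟨hnumP, -, -, hnumC, -⟩ := hnum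
  -- the error factor only improves with the level
  have herr : 1 / (8 * (m : ℝ) ^ (c + 1 + 1)) ≤ 1 / (8 * (m : ℝ) ^ (c + 1)) := by
    have hm0 : (1 : ℝ) ≤ m := by exact_mod_cast hm1
    refine one_div_le_one_div_of_le (by positivity) ?_
    exact mul_le_mul_of_nonneg_left (pow_le_pow_right₀ hm0 (by omega)) (by norm_num)
  by_cases hacc : ∃ v, φ.2 v = true
  · -- Case A: `φ` accepts something; pad with `n'` dummies and apply the r7 leaf at level `c + 1`.
    generalize hn' : ⌊(m : ℝ) ^ (1 / 16 : ℝ)⌋₊ * (Nat.log 2 ⌊(m : ℝ) ^ (1 / 16 : ℝ)⌋₊ + 1) + 1 = n' at hnumP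
    have hlt : ⌊(m : ℝ) ^ (1 / 16 : ℝ)⌋₊ * (Nat.log 2 ⌊(m : ℝ) ^ (1 / 16 : ℝ)⌋₊ + 1) < n' := by
      rw [← hn']
      exact Nat.lt_add_one _
    have hchild : #(univ.image C) + 1 ≤ m ^ (c + 1 + 3) := by omega
    obtain ⟨dnf, cnf, h1, h2, h3, h4, h5⟩ := hm _ ((isPermGate_andPad (m ^ c) n' φ hφ).mono hnumP)
      (not_narrow_andPad _ n' φ hacc hlt)
      (Fin.addCases (motive := fun _ => Finset (Finset ((⊤ : SimpleGraph (Fin m)).edgeSet))) C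
        (fun _ : Fin n' => (∅ : Finset (Finset ((⊤ : SimpleGraph (Fin m)).edgeSet)))))
      ((card_image_andPad_le φ n' C).trans hchild) (andPad_local φ n' s C hCs)
    refine ⟨dnf, cnf, h1, h2, h3,
      (le_of_eq ?_).trans (h4.trans (mul_le_mul_of_nonneg_right herr (Nat.cast_nonneg _))),
      (le_of_eq ?_).trans (h5.trans (mul_le_mul_of_nonneg_right herr (Nat.cast_nonneg _)))⟩
    · exact congrArg (fun S => ((#S : ℕ) : ℝ)) (filter_congr fun x _ => by rw [andPad_cval φ n' C x])
    · exact congrArg (fun S => ((#S : ℕ) : ℝ)) (filter_congr fun x _ => by rw [andPad_cval φ n' C x])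
  · -- Case B: `φ` accepts nothing; the constant `0` is sandwiched by `∅ ≤ {∅}` with no error.
    refine ⟨∅, {∅}, by simp, by simp, ?_, ?_, ?_⟩
    · rintro x ⟨R, hR, -⟩
      simp at hR
    · refine (le_of_eq (b := 0) ?_).trans (by positivity)
      rw [Nat.cast_eq_zero, card_eq_zero, filter_eq_empty_iff]
      rintro x - ⟨hx, -⟩
      exact hacc ⟨_, hx⟩
    · refine (le_of_eq (b := 0) ?_).trans (by positivity)
      rw [Nat.cast_eq_zero, card_eq_zero, filter_eq_empty_iff]
      rintro x - ⟨hx, -⟩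
      obtain ⟨i, hi, -⟩ := hx ∅ (mem_singleton_self _)
      simp at hi

end Summit.PneNP.PneNP.Theorems.CliqueExtLowerBound.WidthThreshold.PermPadLeaf
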